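import Literature.NumberTheory.Automorphic.ArchRankinSelbergOfKirillov
import Literature.NumberTheory.Automorphic.ArchRankinSelbergAbsConvergenceLowRank
import Literature.NumberTheory.Automorphic.ArchKirillovModelUnitary
import Literature.NumberTheory.Automorphic.ArchRankinSelbergAbsConvergence
import Literature.NumberTheory.Automorphic.PairLFunctionPolesEqConjOfArch
import HarnessLib

/-!
# Proof of `JacquetShalika1990_archRankinSelbergLIntegral_lt_top` from the unitarity of the Kirillov model

Topic `NumberTheory/Automorphic`; namespace `Literature.NumberTheory.Automorphic`. Sibling proof file of
`ArchRankinSelbergAbsConvergence` (theorems only). Jacquet–Shalika's archimedean convergence theorem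
"`Ψ_∞(1; W, W̄, Φ)` converges absolutely for unitary generic `π_∞`" (the named fact
`JacquetShalika1990_archRankinSelbergLIntegral_lt_top n K`) is derived in every rank:

* ranks `0` and `1`: unconditional, already in the tree (`ArchRankinSelbergAbsConvergenceLowRank`:
  `JacquetShalika1990_archRankinSelbergLIntegral_lt_top_zero/_one`);
* rank `m + 1 ≥ 2`: the mirabolic reduction `archRankinSelbergLIntegral_lt_top_of_kirillovBound`
  (`ArchRankinSelbergOfKirillov`) fed with the uniform bound on the Kirillov integrals of the translates
  `τ(g) e`, which follows from the unitarity of the Kirillov model (named fact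
  `JacquetShalika1981_archKirillovNorm_eq`, `ArchKirillovModelUnitary`: the Kirillov norm of `τ(g) e` is
  `c ‖τ(g) e‖² = c ‖e‖²`).

Main statements: `kirillovBound_of_archKirillovNorm_eq`,
`JacquetShalika1990_archRankinSelbergLIntegral_lt_top_of_archKirillovNorm_eq` (`∀ n`, from the
Kirillov fact in ranks `≥ 2`), and the consequence for Arthur–Clozel (2.3):
`JacquetShalika1981_partialPairL_pole_of_eq_conj_of_archKirillovNorm_eq` (through the landed
`PairLFunctionPolesEqConjOfArch`); and (§4) the same chain from the INEQUALITY `≤ C ‖v‖²` alone —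
which is exactly what Jacquet–Shalika print, Prop. (3.16), p. 542 — as a spelled-out hypothesis:
`kirillovBound_of_archKirillovNorm_le`, `JacquetShalika1981_archKirillovNorm_eq.le`,
`JacquetShalika1990_archRankinSelbergLIntegral_lt_top_of_archKirillovNorm_le`,
`JacquetShalika1981_partialPairL_pole_of_eq_conj_of_archKirillovNorm_le`. No definition, no named fact.

## References

* H. Jacquet, J. A. Shalika, *On Euler products and the classification of automorphic
  representations I*, Amer. J. Math. 103 (1981), §1; §3, Prop. (3.8) p. 522, Remark (3.15)(1) p. 541,
  Prop. (3.16) and Prop. (3.17) p. 542 [JacquetShalikaAJM1981].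
* J. W. Cogdell, *Analytic theory of L-functions for GL_n* (2004), §3.1 (1), §3.2 [CogdellAnalyticTheory2004].
-/

noncomputable section

open MeasureTheory Measure NumberField NumberField.mixedEmbedding IsDedekindDomain Set Filter
open scoped MatrixGroups ENNReal NNReal Classical Topology

namespace Literature.NumberTheory.Automorphic

variable {m : ℕ} {K : Type} [Field K] [NumberField K]

attribute [local instance] glInfBorel borelSpace_glInf locallyCompactSpace_glInf secondCountableTopology_glInf
  Literature.MeasureTheory.Group.Units.borelSpace_of_isOpenEmbedding
  Literature.MeasureTheory.Group.hasSummableGeomSeries_of_finiteDimensional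

/-! ### 1. The Kirillov bound from the unitarity of the Kirillov model -/

section KirillovBound

variable (hcpt : isCompact_glFiniteIntegralLevel (m + 1) K)
  {E : Type} [NormedAddCommGroup E] [InnerProductSpace ℂ E] [CompleteSpace E]
  (τ : ContRepresentation ℂ (AutomorphyDatum.gl (m + 1) K hcpt).arch.carrier E) (hτ : τ.IsStronglyContinuous)

/-- **The Kirillov integrals of the translates `τ(g) e` are bounded** (indeed constant, `= c ‖e‖²`) for
`τ` irreducible unitary, `ℓ` a continuous Whittaker functional and `e` Gårding, by the unitarity of the
Kirillov model (`JacquetShalika1981_archKirillovNorm_eq`) and `‖τ(g) e‖ = ‖e‖`: the hypothesis `hKir` of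
`archRankinSelbergLIntegral_lt_top_of_kirillovBound`. [cite: JacquetShalikaAJM1981, §3] -/
theorem kirillovBound_of_archKirillovNorm_eq (hm : 1 ≤ m) (hP : JacquetShalika1981_archKirillovNorm_eq m K)
    (hτu : τ.IsUnitary) (hτi : τ.IsTopIrreducible) {ℓ : archGardingSpace hcpt τ →ₗ[ℂ] ℂ}
    (hℓ : IsArchContWhittakerFunctional hcpt τ hτ ℓ) (e : archGardingSpace hcpt τ)
    (μ' : Measure (Fin m → (mixedSpace K)ˣ)) [hμ' : IsHaarMeasure μ'] (μK' : Measure ↥(Kinf m K))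
    [hμK' : IsHaarMeasure μK'] :
    ∃ C : ℝ≥0∞, C ≠ ⊤ ∧ ∀ g : GL (Fin (m + 1)) (mixedSpace K),
      ∫⁻ p : (Fin m → (mixedSpace K)ˣ) × ↥(Kinf m K),
        ‖ℓ ⟨τ (toArch hcpt (GLn.cornerSucc (mixedSpace K)
            (glDiagonal m (mixedSpace K) p.1 * (p.2 : GL (Fin m) (mixedSpace K))) * g)) (e : E),
          apply_mem_archGardingSpace hτ _ e.2⟩‖ₑ ^ 2 *
          ENNReal.ofReal (archTorusWeight m K 0 p.1) ∂(μ'.prod μK') ≤ C := by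
  obtain ⟨c, hc, h⟩ := hP hm hcpt E τ hτ hτu hτi ℓ hℓ μ' hμ' μK' hμK'
  refine ⟨c * ‖(e : E)‖ₑ ^ 2, ENNReal.mul_ne_top hc (ENNReal.pow_ne_top enorm_ne_top), fun g => le_of_eq ?_⟩
  have hg : ∀ p : (Fin m → (mixedSpace K)ˣ) × ↥(Kinf m K),
      τ (toArch hcpt (GLn.cornerSucc (mixedSpace K)
        (glDiagonal m (mixedSpace K) p.1 * (p.2 : GL (Fin m) (mixedSpace K))) * g)) (e : E) =
      τ (toArch hcpt (GLn.cornerSucc (mixedSpace K)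
        (glDiagonal m (mixedSpace K) p.1 * (p.2 : GL (Fin m) (mixedSpace K))))) (τ (toArch hcpt g) (e : E)) :=
    fun p => by rw [← mul_apply_eq_comp, ← map_mul]; rfl
  simp_rw [hg]
  rw [h ⟨τ (toArch hcpt g) (e : E), apply_mem_archGardingSpace hτ _ e.2⟩]
  congr 2
  change ‖τ (toArch hcpt g) (e : E)‖ₑ = ‖(e : E)‖ₑ
  rw [← ofReal_norm, ← ofReal_norm, hτu.norm_map]

end KirillovBound

/-! ### 2. All ranks -/

/-- **Jacquet–Shalika's archimedean convergence theorem from the unitarity of the Kirillov model**: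
`JacquetShalika1990_archRankinSelbergLIntegral_lt_top n K` in every rank `n`, from the Kirillov fact in
the ranks `m + 1 ≥ 2` (ranks `0` and `1` unconditionally). [cite: JacquetShalikaAJM1981, §3]
[cite: CogdellAnalyticTheory2004, §3.1 item (1) and §3.2] -/
theorem JacquetShalika1990_archRankinSelbergLIntegral_lt_top_of_archKirillovNorm_eq
    (hP : ∀ m : ℕ, JacquetShalika1981_archKirillovNorm_eq m K) :
    ∀ n : ℕ, JacquetShalika1990_archRankinSelbergLIntegral_lt_top n K
  | 0 => JacquetShalika1990_archRankinSelbergLIntegral_lt_top_zero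
  | 1 => JacquetShalika1990_archRankinSelbergLIntegral_lt_top_one
  | m + 2 => by
    intro hcpt E _ _ _ τ hτ hτu hτi ℓ hℓ e instGL instBGL instU instBU μA hμA μK hμK
    -- normalise the σ-algebras to the tree's (Borel) instances
    have hGL : instGL = glInfBorel (m + 2) K := @BorelSpace.measurable_eq _ _ instGL instBGL
    have hU : instU = Units.instMeasurableSpace :=
      (@BorelSpace.measurable_eq _ _ instU instBU).trans
        (@BorelSpace.measurable_eq _ _ (Units.instMeasurableSpace)
          (Literature.MeasureTheory.Group.Units.borelSpace_of_isOpenEmbedding)).symm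
    subst hGL
    subst hU
    haveI := hμA
    haveI := hμK
    refine archRankinSelbergLIntegral_lt_top_of_kirillovBound hcpt τ hτ ℓ e (fun μ' _ μK' _ => ?_) μA μK
    exact kirillovBound_of_archKirillovNorm_eq hcpt τ hτ (Nat.succ_le_succ (Nat.zero_le m)) (hP (m + 1))
      hτu hτi hℓ e μ' μK'

/-! ### 3. Arthur–Clozel (2.3) from the unitarity of the Kirillov model -/

section ArthurClozel

variable {n : ℕ} {μ : Measure (AdelicGroupData.gl n K).automorphicQuotient}
  [(AdelicGroupData.gl n K).IsAutomorphicMeasure μ]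

/-- **Arthur–Clozel, Ch. 3 (2.3), in rank `n`, from the unitarity of the archimedean Kirillov model**
(named fact `JacquetShalika1981_archKirillovNorm_eq` in the ranks `m + 1 ≥ 2` ⟹ Jacquet–Shalika's
archimedean convergence in every rank ⟹ (2.3) by the landed
`JacquetShalika1981_partialPairL_pole_of_eq_conj_of_archRankinSelbergLIntegral_lt_top`).
[cite: ArthurClozelAMS120, Ch. 3 §2, (2.3), p. 171] [cite: JacquetShalikaAJM1981, §3–§4] -/
theorem JacquetShalika1981_partialPairL_pole_of_eq_conj_of_archKirillovNorm_eq
    (hP : ∀ m : ℕ, JacquetShalika1981_archKirillovNorm_eq m K) :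
    JacquetShalika1981_partialPairL_pole_of_eq_conj (n := n) (K := K) (μ := μ) :=
  JacquetShalika1981_partialPairL_pole_of_eq_conj_of_archRankinSelbergLIntegral_lt_top
    (JacquetShalika1990_archRankinSelbergLIntegral_lt_top_of_archKirillovNorm_eq hP n)

end ArthurClozel

/-! ### 4. The same from the INEQUALITY `‖v‖²_{Kir} ≤ C ‖v‖²` (Jacquet–Shalika I, Prop. (3.16))

What the mirabolic reduction consumes is only the upper bound of the Kirillov norms by the Hilbert
norm, which is exactly what Jacquet–Shalika print: *"(3.16) Proposition. Notations being as above,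
there is a positive constant `c` such that `∫_{N\P} |W|²(pg) d_r(p) ≤ c ‖W‖²` for all
`W ∈ 𝒲₀(π; ψ)` and all `g ∈ G`"* (Amer. J. Math. 103 (1981), p. 542; `π` irreducible unitary
generic, `𝒲₀` the Whittaker functions of `K`-finite vectors, `‖W‖ = ‖v‖`; the bound for all `g`
covers the non-`K`-finite translates `π(g) v`). The theorems below record the whole chain from this
inequality — stated as a HYPOTHESIS on Gårding vectors, spelled out (no named fact) — so that the
equality `= c ‖v‖²` of `JacquetShalika1981_archKirillovNorm_eq` (which needs in addition
`π|_{P} ≅ τ_r`, loc. cit. Remark (3.15)(1) / Baruch (2003)) is seen to be more than is used. -/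

section KirillovLe

variable (hcpt : isCompact_glFiniteIntegralLevel (m + 1) K)
  {E : Type} [NormedAddCommGroup E] [InnerProductSpace ℂ E] [CompleteSpace E]
  (τ : ContRepresentation ℂ (AutomorphyDatum.gl (m + 1) K hcpt).arch.carrier E) (hτ : τ.IsStronglyContinuous)

/-- **The Kirillov integrals of the translates `τ(g) e` are bounded** as soon as the Kirillov norm
of every Gårding vector is bounded by `C ‖v‖²` (Jacquet–Shalika I, Prop. (3.16)) and `τ` is
unitary (`‖τ(g) e‖ = ‖e‖`): the hypothesis `hKir` of `archRankinSelbergLIntegral_lt_top_of_kirillovBound`.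
[cite: JacquetShalikaAJM1981, Prop. (3.16), p. 542] -/
theorem kirillovBound_of_archKirillovNorm_le (hτu : τ.IsUnitary) {ℓ : archGardingSpace hcpt τ →ₗ[ℂ] ℂ}
    (e : archGardingSpace hcpt τ)
    (μ' : Measure (Fin m → (mixedSpace K)ˣ)) (μK' : Measure ↥(Kinf m K))
    (hle : ∃ C : ℝ≥0∞, C ≠ ⊤ ∧ ∀ v : archGardingSpace hcpt τ,
      ∫⁻ p : (Fin m → (mixedSpace K)ˣ) × ↥(Kinf m K),
        ‖ℓ ⟨τ (toArch hcpt (GLn.cornerSucc (mixedSpace K)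
            (glDiagonal m (mixedSpace K) p.1 * (p.2 : GL (Fin m) (mixedSpace K))))) (v : E),
          apply_mem_archGardingSpace hτ _ v.2⟩‖ₑ ^ 2 *
          ENNReal.ofReal (archTorusWeight m K 0 p.1) ∂(μ'.prod μK') ≤ C * ‖(v : E)‖ₑ ^ 2) :
    ∃ C : ℝ≥0∞, C ≠ ⊤ ∧ ∀ g : GL (Fin (m + 1)) (mixedSpace K),
      ∫⁻ p : (Fin m → (mixedSpace K)ˣ) × ↥(Kinf m K),
        ‖ℓ ⟨τ (toArch hcpt (GLn.cornerSucc (mixedSpace K)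
            (glDiagonal m (mixedSpace K) p.1 * (p.2 : GL (Fin m) (mixedSpace K))) * g)) (e : E),
          apply_mem_archGardingSpace hτ _ e.2⟩‖ₑ ^ 2 *
          ENNReal.ofReal (archTorusWeight m K 0 p.1) ∂(μ'.prod μK') ≤ C := by
  obtain ⟨c, hc, h⟩ := hle
  refine ⟨c * ‖(e : E)‖ₑ ^ 2, ENNReal.mul_ne_top hc (ENNReal.pow_ne_top enorm_ne_top), fun g => ?_⟩
  have hg : ∀ p : (Fin m → (mixedSpace K)ˣ) × ↥(Kinf m K),
      τ (toArch hcpt (GLn.cornerSucc (mixedSpace K)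
        (glDiagonal m (mixedSpace K) p.1 * (p.2 : GL (Fin m) (mixedSpace K))) * g)) (e : E) =
      τ (toArch hcpt (GLn.cornerSucc (mixedSpace K)
        (glDiagonal m (mixedSpace K) p.1 * (p.2 : GL (Fin m) (mixedSpace K))))) (τ (toArch hcpt g) (e : E)) :=
    fun p => by rw [← mul_apply_eq_comp, ← map_mul]; rfl
  simp_rw [hg]
  refine (h ⟨τ (toArch hcpt g) (e : E), apply_mem_archGardingSpace hτ _ e.2⟩).trans (le_of_eq ?_)
  congr 2
  change ‖τ (toArch hcpt g) (e : E)‖ₑ = ‖(e : E)‖ₑ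
  rw [← ofReal_norm, ← ofReal_norm, hτu.norm_map]

end KirillovLe

/-- The equality `= c ‖v‖²` of the Kirillov fact implies the inequality `≤ c ‖v‖²` of
Jacquet–Shalika I, Prop. (3.16), in the same vocabulary. [cite: JacquetShalikaAJM1981, Prop. (3.16), p. 542] -/
theorem JacquetShalika1981_archKirillovNorm_eq.le (hP : JacquetShalika1981_archKirillovNorm_eq m K)
    (hm : 1 ≤ m) (hcpt : isCompact_glFiniteIntegralLevel (m + 1) K) (E : Type) [NormedAddCommGroup E]
    [InnerProductSpace ℂ E] [CompleteSpace E]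
    (τ : ContRepresentation ℂ (AutomorphyDatum.gl (m + 1) K hcpt).arch.carrier E) (hτ : τ.IsStronglyContinuous)
    (hτu : τ.IsUnitary) (hτi : τ.IsTopIrreducible)
    (ℓ : archGardingSpace hcpt τ →ₗ[ℂ] ℂ) (hℓ : IsArchContWhittakerFunctional hcpt τ hτ ℓ)
    [MeasurableSpace (GL (Fin m) (mixedSpace K))] [BorelSpace (GL (Fin m) (mixedSpace K))]
    [MeasurableSpace ((mixedSpace K)ˣ)] [BorelSpace ((mixedSpace K)ˣ)]
    (μ' : Measure (Fin m → (mixedSpace K)ˣ)) (hμ' : IsHaarMeasure μ')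
    (μK' : Measure ↥(Kinf m K)) (hμK' : IsHaarMeasure μK') :
    ∃ C : ℝ≥0∞, C ≠ ⊤ ∧ ∀ v : archGardingSpace hcpt τ,
      ∫⁻ p : (Fin m → (mixedSpace K)ˣ) × ↥(Kinf m K),
        ‖ℓ ⟨τ (toArch hcpt (GLn.cornerSucc (mixedSpace K)
            (glDiagonal m (mixedSpace K) p.1 * (p.2 : GL (Fin m) (mixedSpace K))))) (v : E),
          apply_mem_archGardingSpace hτ _ v.2⟩‖ₑ ^ 2 *
          ENNReal.ofReal (archTorusWeight m K 0 p.1) ∂(μ'.prod μK') ≤ C * ‖(v : E)‖ₑ ^ 2 := by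
  obtain ⟨c, hc, h⟩ := hP hm hcpt E τ hτ hτu hτi ℓ hℓ μ' hμ' μK' hμK'
  exact ⟨c, hc, fun v => (h v).le⟩

/-- **Jacquet–Shalika's archimedean convergence theorem in every rank from the INEQUALITY of
Jacquet–Shalika I, Prop. (3.16)** (the Kirillov norm of a Gårding vector of an irreducible unitary
representation of `GL_{m+1}(K_∞)`, `m ≥ 1`, is at most `C ‖v‖²` — hypothesis `hle`, spelled out for
all ranks `m + 1 ≥ 2`): `JacquetShalika1990_archRankinSelbergLIntegral_lt_top n K` for every `n`
(ranks `0`, `1` unconditionally). [cite: JacquetShalikaAJM1981, Prop. (3.16) and Prop. (3.17)(i), p. 542] -/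
theorem JacquetShalika1990_archRankinSelbergLIntegral_lt_top_of_archKirillovNorm_le
    (hle : ∀ m : ℕ, 1 ≤ m → ∀ (hcpt : isCompact_glFiniteIntegralLevel (m + 1) K) (E : Type) [NormedAddCommGroup E]
      [InnerProductSpace ℂ E] [CompleteSpace E]
      (τ : ContRepresentation ℂ (AutomorphyDatum.gl (m + 1) K hcpt).arch.carrier E) (hτ : τ.IsStronglyContinuous)
      (_ : τ.IsUnitary) (_ : τ.IsTopIrreducible)
      (ℓ : archGardingSpace hcpt τ →ₗ[ℂ] ℂ) (_ : IsArchContWhittakerFunctional hcpt τ hτ ℓ)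
      [MeasurableSpace (GL (Fin m) (mixedSpace K))] [BorelSpace (GL (Fin m) (mixedSpace K))]
      [MeasurableSpace ((mixedSpace K)ˣ)] [BorelSpace ((mixedSpace K)ˣ)]
      (μ' : Measure (Fin m → (mixedSpace K)ˣ)) (_ : IsHaarMeasure μ')
      (μK' : Measure ↥(Kinf m K)) (_ : IsHaarMeasure μK'),
      ∃ C : ℝ≥0∞, C ≠ ⊤ ∧ ∀ v : archGardingSpace hcpt τ,
        ∫⁻ p : (Fin m → (mixedSpace K)ˣ) × ↥(Kinf m K),
          ‖ℓ ⟨τ (toArch hcpt (GLn.cornerSucc (mixedSpace K)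
              (glDiagonal m (mixedSpace K) p.1 * (p.2 : GL (Fin m) (mixedSpace K))))) (v : E),
            apply_mem_archGardingSpace hτ _ v.2⟩‖ₑ ^ 2 *
            ENNReal.ofReal (archTorusWeight m K 0 p.1) ∂(μ'.prod μK') ≤ C * ‖(v : E)‖ₑ ^ 2) :
    ∀ n : ℕ, JacquetShalika1990_archRankinSelbergLIntegral_lt_top n K
  | 0 => JacquetShalika1990_archRankinSelbergLIntegral_lt_top_zero
  | 1 => JacquetShalika1990_archRankinSelbergLIntegral_lt_top_one
  | m + 2 => by
    intro hcpt E _ _ _ τ hτ hτu hτi ℓ hℓ e instGL instBGL instU instBU μA hμA μK hμK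
    -- normalise the σ-algebras to the tree's (Borel) instances
    have hGL : instGL = glInfBorel (m + 2) K := @BorelSpace.measurable_eq _ _ instGL instBGL
    have hU : instU = Units.instMeasurableSpace :=
      (@BorelSpace.measurable_eq _ _ instU instBU).trans
        (@BorelSpace.measurable_eq _ _ (Units.instMeasurableSpace)
          (Literature.MeasureTheory.Group.Units.borelSpace_of_isOpenEmbedding)).symm
    subst hGL
    subst hU
    haveI := hμA
    haveI := hμK
    refine archRankinSelbergLIntegral_lt_top_of_kirillovBound hcpt τ hτ ℓ e (fun μ' hμ' μK' hμK' => ?_) μA μK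
    exact kirillovBound_of_archKirillovNorm_le hcpt τ hτ hτu e μ' μK'
      (hle (m + 1) (Nat.succ_le_succ (Nat.zero_le m)) hcpt E τ hτ hτu hτi ℓ hℓ μ' hμ' μK' hμK')

section ArthurClozelLe

variable {n : ℕ} {μ : Measure (AdelicGroupData.gl n K).automorphicQuotient}
  [(AdelicGroupData.gl n K).IsAutomorphicMeasure μ]

/-- **Arthur–Clozel, Ch. 3 (2.3), in rank `n`, from the INEQUALITY of Jacquet–Shalika I,
Prop. (3.16)** (Kirillov norm `≤ C ‖v‖²` for the Gårding vectors of the irreducible unitary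
representations of `GL_{m+1}(K_∞)`, `m ≥ 1` — hypothesis `hle` as in
`JacquetShalika1990_archRankinSelbergLIntegral_lt_top_of_archKirillovNorm_le`).
[cite: ArthurClozelAMS120, Ch. 3 §2, (2.3), p. 171] [cite: JacquetShalikaAJM1981, Prop. (3.16), Prop. (3.17), §4] -/
theorem JacquetShalika1981_partialPairL_pole_of_eq_conj_of_archKirillovNorm_le
    (hle : ∀ m : ℕ, 1 ≤ m → ∀ (hcpt : isCompact_glFiniteIntegralLevel (m + 1) K) (E : Type) [NormedAddCommGroup E]
      [InnerProductSpace ℂ E] [CompleteSpace E]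
      (τ : ContRepresentation ℂ (AutomorphyDatum.gl (m + 1) K hcpt).arch.carrier E) (hτ : τ.IsStronglyContinuous)
      (_ : τ.IsUnitary) (_ : τ.IsTopIrreducible)
      (ℓ : archGardingSpace hcpt τ →ₗ[ℂ] ℂ) (_ : IsArchContWhittakerFunctional hcpt τ hτ ℓ)
      [MeasurableSpace (GL (Fin m) (mixedSpace K))] [BorelSpace (GL (Fin m) (mixedSpace K))]
      [MeasurableSpace ((mixedSpace K)ˣ)] [BorelSpace ((mixedSpace K)ˣ)]
      (μ' : Measure (Fin m → (mixedSpace K)ˣ)) (_ : IsHaarMeasure μ')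
      (μK' : Measure ↥(Kinf m K)) (_ : IsHaarMeasure μK'),
      ∃ C : ℝ≥0∞, C ≠ ⊤ ∧ ∀ v : archGardingSpace hcpt τ,
        ∫⁻ p : (Fin m → (mixedSpace K)ˣ) × ↥(Kinf m K),
          ‖ℓ ⟨τ (toArch hcpt (GLn.cornerSucc (mixedSpace K)
              (glDiagonal m (mixedSpace K) p.1 * (p.2 : GL (Fin m) (mixedSpace K))))) (v : E),
            apply_mem_archGardingSpace hτ _ v.2⟩‖ₑ ^ 2 *
            ENNReal.ofReal (archTorusWeight m K 0 p.1) ∂(μ'.prod μK') ≤ C * ‖(v : E)‖ₑ ^ 2) :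
    JacquetShalika1981_partialPairL_pole_of_eq_conj (n := n) (K := K) (μ := μ) :=
  JacquetShalika1981_partialPairL_pole_of_eq_conj_of_archRankinSelbergLIntegral_lt_top
    (JacquetShalika1990_archRankinSelbergLIntegral_lt_top_of_archKirillovNorm_le hle n)

end ArthurClozelLe

/-! ### 5. From the named fact `JacquetShalika1981_archKirillovNorm_le` (Jacquet–Shalika I, (3.16)) -/

/-- **Jacquet–Shalika's archimedean convergence theorem in every rank from the named Kirillov bound**
`JacquetShalika1981_archKirillovNorm_le` (Jacquet–Shalika I, (3.16) Proposition) in the ranks `m + 1 ≥ 2`.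
[cite: JacquetShalikaAJM1981, (3.16) Proposition and Prop. (3.17)(i), p. 542] -/
theorem JacquetShalika1990_archRankinSelbergLIntegral_lt_top_of_archKirillovNorm_le_fact
    (hP : ∀ m : ℕ, JacquetShalika1981_archKirillovNorm_le m K) :
    ∀ n : ℕ, JacquetShalika1990_archRankinSelbergLIntegral_lt_top n K :=
  JacquetShalika1990_archRankinSelbergLIntegral_lt_top_of_archKirillovNorm_le fun m hm => hP m hm

section ArthurClozelLeFact

variable {n : ℕ} {μ : Measure (AdelicGroupData.gl n K).automorphicQuotient}
  [(AdelicGroupData.gl n K).IsAutomorphicMeasure μ]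

/-- **Arthur–Clozel, Ch. 3 (2.3), in rank `n`, from the named Kirillov bound**
`JacquetShalika1981_archKirillovNorm_le` (Jacquet–Shalika I, (3.16) Proposition, the inequality
`≤ c ‖v‖²`) in the ranks `m + 1 ≥ 2` — the weakest archimedean input recorded in the tree for (2.3).
[cite: ArthurClozelAMS120, Ch. 3 §2, (2.3), p. 171] [cite: JacquetShalikaAJM1981, (3.16), (3.17), §4] -/
theorem JacquetShalika1981_partialPairL_pole_of_eq_conj_of_archKirillovNorm_le_fact
    (hP : ∀ m : ℕ, JacquetShalika1981_archKirillovNorm_le m K) :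
    JacquetShalika1981_partialPairL_pole_of_eq_conj (n := n) (K := K) (μ := μ) :=
  JacquetShalika1981_partialPairL_pole_of_eq_conj_of_archRankinSelbergLIntegral_lt_top
    (JacquetShalika1990_archRankinSelbergLIntegral_lt_top_of_archKirillovNorm_le_fact hP n)

end ArthurClozelLeFact

end Literature.NumberTheory.Automorphic
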